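import Summits.Ventures.HodgeRepro2.T5SU11JacobiOrbitMomentRate

/-!
# The orbit-moment rates for EVERY real spectral parameter: `|k² ⟨|g·0|⁴⟩ − 8| ≤ (48 + 16μ + μ²)/k` and
`|Var(k|g·0|²/2) − 1| ≤ (12 + 5μ + μ²/2)/k`, `μ = |λ(λ − 2)|`, on the whole ray

`T5SU11JacobiOrbitMomentRate` gives the first two orbit moments in rational closed form on the whole ray,
`k ⟨|g·0|²⟩ = 2 + λ(λ − 2)/k` and `k² ⟨|g·0|⁴⟩ = (8k² + (16 + 8λ(λ − 2))k + 8λ(λ − 2) + λ(λ − 2)²)/(k + 2)²`, but states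
the rates only on the Jensen range (`|λ(λ − 2)| ≤ 1`). The closed forms give them for EVERY real `λ` on the ray, with
`μ = |λ(λ − 2)|`:

* **`|k² ⟨|g·0|⁴⟩_{k,λ} − 8| ≤ (48 + 16μ + μ²)/k`** (`abs_sq_mul_moment_orbit_sq_two_sub_eight_le_all`) — from
  `k² ⟨|g·0|⁴⟩ − 8 = ((8λ(λ − 2) − 16)k + 8λ(λ − 2) + λ(λ − 2)² − 32)/(k + 2)²`;
* **`|Var_{k,λ}(k|g·0|²/2) − 1| ≤ (12 + 5μ + μ²/2)/k`** (`abs_sq_div_four_mul_variance_orbit_sq_sub_one_le_all`) — with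
  `(k ⟨|g·0|²⟩)² = 4 + 4λ(λ − 2)/k + λ(λ − 2)²/k²`.

Together with `T5SU11JacobiOrbitMomentRate.abs_mul_mean_orbit_sq_sub_two` (`|k ⟨|g·0|²⟩ − 2| = μ/k`, exact, every `λ`) and
`T5SU11JacobiRatesAll` (the phase side), every first- and second-order statistic of the explicit model now has an
explicit `O(1/k)` rate for every real spectral parameter. Constants explicit, not optimised. Nothing is claimed
about (N).

Blind lane: Mathlib + the HodgeRepro2 prefix only; no sorry; axioms ⊆ {propext, Classical.choice,
Quot.sound}.
-/

namespace Summit.Ventures.HodgeRepro2.T5SU11JacobiOrbitMomentRateAll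

open MeasureTheory MeasureTheory.Measure Metric Set Filter Topology
open T5SU11Unimodular T5SU11Fibration T5SU11Cartan T5SU11CartanProjection T5HaarCircle
  T5BergmanCoefficient T5SU11FibrationHaar T5SU11SphericalFunction T5SU11SphericalSymmetry
  T5SU11SphericalBounds T5SU11SphericalContinuous T5SU11JacobiIwasawa T5SU11JacobiTransform
  T5SU11JacobiWeight T5SU11KFiniteMajorantPow T5SU11JacobiWeightRecursion T5SU11JacobiPhaseMGF
  T5SU11JacobiOrbitMoments T5SU11JacobiOrbitMomentRate
open scoped Real

/-! ### The elementary rational inequality -/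

/-- `|((8μ − 16)k + 8μ + μ² − 32)/(k + 2)²| ≤ (48 + 16|μ| + μ²)/k` for `k ≥ 1`. -/
theorem abs_rational_le {k μ : ℝ} (hk : 1 ≤ k) :
    |((8 * μ - 16) * k + 8 * μ + μ ^ 2 - 32) / (k + 2) ^ 2| ≤ (48 + 16 * |μ| + μ ^ 2) / k := by
  have hk0 : 0 < k := by linarith
  have hk2 : 0 < (k + 2) ^ 2 := by positivity
  rw [abs_div, abs_of_pos hk2, div_le_div_iff₀ hk2 hk0]
  have hμ : |μ| ≥ 0 := abs_nonneg μ
  have h1 : |(8 * μ - 16) * k + 8 * μ + μ ^ 2 - 32| ≤ (8 * |μ| + 16) * k + 8 * |μ| + μ ^ 2 + 32 := by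
    have ha := le_abs_self μ
    have hb := neg_abs_le μ
    have hak := mul_le_mul_of_nonneg_right ha hk0.le
    have hbk := mul_le_mul_of_nonneg_right hb hk0.le
    rw [abs_le]
    constructor <;> nlinarith
  -- `((8|μ| + 16)k + 8|μ| + μ² + 32) k ≤ (48 + 16|μ| + μ²)(k + 2)²` for `k ≥ 1`
  calc |(8 * μ - 16) * k + 8 * μ + μ ^ 2 - 32| * k
      ≤ ((8 * |μ| + 16) * k + 8 * |μ| + μ ^ 2 + 32) * k := mul_le_mul_of_nonneg_right h1 hk0.le
    _ ≤ (48 + 16 * |μ| + μ ^ 2) * (k + 2) ^ 2 := by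
        nlinarith [mul_nonneg hμ hk0.le, sq_nonneg μ, mul_nonneg (sq_nonneg μ) hk0.le, sq_nonneg k,
          mul_nonneg hμ (sq_nonneg k), mul_nonneg (sq_nonneg μ) (sq_nonneg k)]

section measure

variable [MeasurableSpace Circle] [BorelSpace Circle]

/-- **THE RATE OF THE SECOND ORBIT MOMENT FOR EVERY `λ`**: on the ray,
`|k² ⟨|g·0|⁴⟩_{k,λ} − 8| ≤ (48 + 16|λ(λ − 2)| + λ(λ − 2)²)/k`. -/
theorem abs_sq_mul_moment_orbit_sq_two_sub_eight_le_all {k lam : ℝ} (hk : 1 < k) (h1 : lam < k)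
    (h2 : 2 < k + lam) :
    |k ^ 2 * ((∫ g, (‖orbit g‖ ^ 2) ^ 2 * ((1 - ‖orbit g‖ ^ 2) ^ (k / 2) * sph lam g) ∂(nu haarCircle))
        / ∫ g, (1 - ‖orbit g‖ ^ 2) ^ (k / 2) * sph lam g ∂(nu haarCircle)) - 8|
      ≤ (48 + 16 * |lam * (lam - 2)| + (lam * (lam - 2)) ^ 2) / k := by
  rw [sq_mul_moment_orbit_sq_two_eq hk h1 h2]
  have hk2 : (k + 2) ^ 2 ≠ 0 := by positivity
  have e : (8 * k ^ 2 + (16 + 8 * (lam * (lam - 2))) * k + 8 * (lam * (lam - 2)) + (lam * (lam - 2)) ^ 2)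
      / (k + 2) ^ 2 - 8
      = ((8 * (lam * (lam - 2)) - 16) * k + 8 * (lam * (lam - 2)) + (lam * (lam - 2)) ^ 2 - 32) / (k + 2) ^ 2 := by
    field_simp
    ring
  rw [e]
  exact abs_rational_le hk.le

/-- **THE RATE OF THE VARIANCE OF THE RESCALED ORBIT RADIUS FOR EVERY `λ`**: on the ray,
`|Var_{k,λ}(k|g·0|²/2) − 1| ≤ (12 + 5|λ(λ − 2)| + λ(λ − 2)²/2)/k`. -/
theorem abs_sq_div_four_mul_variance_orbit_sq_sub_one_le_all {k lam : ℝ} (hk : 1 < k) (h1 : lam < k)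
    (h2 : 2 < k + lam) :
    |k ^ 2 / 4 * ((∫ g, (‖orbit g‖ ^ 2) ^ 2 * ((1 - ‖orbit g‖ ^ 2) ^ (k / 2) * sph lam g) ∂(nu haarCircle))
          / (∫ g, (1 - ‖orbit g‖ ^ 2) ^ (k / 2) * sph lam g ∂(nu haarCircle))
        - ((∫ g, ‖orbit g‖ ^ 2 * ((1 - ‖orbit g‖ ^ 2) ^ (k / 2) * sph lam g) ∂(nu haarCircle))
          / (∫ g, (1 - ‖orbit g‖ ^ 2) ^ (k / 2) * sph lam g ∂(nu haarCircle))) ^ 2) - 1|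
      ≤ (12 + 5 * |lam * (lam - 2)| + (lam * (lam - 2)) ^ 2 / 2) / k := by
  have hk0 : 0 < k := by linarith
  have hA := abs_sq_mul_moment_orbit_sq_two_sub_eight_le_all hk h1 h2
  have hB := mul_mean_orbit_sq_eq hk h1 h2
  set M4 : ℝ := (∫ g, (‖orbit g‖ ^ 2) ^ 2 * ((1 - ‖orbit g‖ ^ 2) ^ (k / 2) * sph lam g) ∂(nu haarCircle))
    / ∫ g, (1 - ‖orbit g‖ ^ 2) ^ (k / 2) * sph lam g ∂(nu haarCircle) with hM4
  set M2 : ℝ := (∫ g, ‖orbit g‖ ^ 2 * ((1 - ‖orbit g‖ ^ 2) ^ (k / 2) * sph lam g) ∂(nu haarCircle))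
    / ∫ g, (1 - ‖orbit g‖ ^ 2) ^ (k / 2) * sph lam g ∂(nu haarCircle) with hM2
  set μ : ℝ := lam * (lam - 2) with hμ
  -- `k²/4 (M4 − M2²) − 1 = (k² M4 − 8)/4 − ((k M2)² − 4)/4`, `(k M2)² − 4 = 4μ/k + μ²/k²`
  have e : k ^ 2 / 4 * (M4 - M2 ^ 2) - 1 = (k ^ 2 * M4 - 8) / 4 - ((k * M2) ^ 2 - 4) / 4 := by ring
  have hB' : (k * M2) ^ 2 - 4 = 4 * μ / k + μ ^ 2 / k ^ 2 := by
    rw [hB]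
    field_simp
    ring
  have hμk : |4 * μ / k + μ ^ 2 / k ^ 2| ≤ (4 * |μ| + μ ^ 2) / k := by
    have hk1 : 1 ≤ k := hk.le
    calc |4 * μ / k + μ ^ 2 / k ^ 2| ≤ |4 * μ / k| + |μ ^ 2 / k ^ 2| := abs_add_le _ _
      _ = 4 * |μ| / k + μ ^ 2 / k ^ 2 := by
          rw [abs_div, abs_div, abs_mul, abs_of_pos (by norm_num : (0 : ℝ) < 4), abs_of_pos hk0, abs_pow, sq_abs,
            abs_pow, abs_of_pos hk0]
      _ ≤ 4 * |μ| / k + μ ^ 2 / k := by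
          gcongr
          nlinarith
      _ = (4 * |μ| + μ ^ 2) / k := by ring
  rw [e, hB']
  calc |(k ^ 2 * M4 - 8) / 4 - (4 * μ / k + μ ^ 2 / k ^ 2) / 4|
      ≤ |(k ^ 2 * M4 - 8) / 4| + |(4 * μ / k + μ ^ 2 / k ^ 2) / 4| := abs_sub _ _
    _ = |k ^ 2 * M4 - 8| / 4 + |4 * μ / k + μ ^ 2 / k ^ 2| / 4 := by
        rw [abs_div, abs_div, abs_of_pos (by norm_num : (0 : ℝ) < 4)]
    _ ≤ ((48 + 16 * |μ| + μ ^ 2) / k) / 4 + ((4 * |μ| + μ ^ 2) / k) / 4 := by gcongr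
    _ = (12 + 5 * |μ| + μ ^ 2 / 2) / k := by ring

end measure

end Summit.Ventures.HodgeRepro2.T5SU11JacobiOrbitMomentRateAll
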